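import Mathlib
import Summits.MatrixMultiplication.MatrixMultiplication.Theorems.SubgroupIdentityDesigns.Negative.TopLevel

/-!
# Stub `stub_isotypicSplitting` — line `ghost-calculus-chebotarev` of the crux
`SubgroupIdentityDesigns` (stmt-MatrixMultiplication-14079)

Crux
`Summit.MatrixMultiplication.MatrixMultiplication.Theses.LevelGradedCohnUmans.SubgroupIdentityDesigns`;
this file proves the registered stub `stub_isotypicSplitting` verbatim (name + signature) and lands
`--supports stmt-MatrixMultiplication-14079`.

Content (isotypic splitting along the two abelian radicals).  `G = GL_m(𝔽_p)`,
`ψ = ZMod.stdAddChar`.  `U⁻ = {u : u - 1 supported in {(i,j) : k ≤ i, j < k}}` is the unipotent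
radical `{[[1,0],[X,1]]}` of the opposite maximal parabolic of type `(k, m-k)`,
`U⁺ = {v : v - 1 supported in {(i,j) : i < k, k ≤ j}}` the radical `{[[1,Z],[0,1]]}`.  A ghost is
`λ : G → ℂ` supported on `H₁H₂H₃` with all level-`k` Fourier sums `Σ_g λ(g) ψ(tr(M g))`
(`rk M ≤ k`) zero.  SANDWICH hypothesis: `U⁻ ≤ H₁`, `U⁺ ≤ H₃`.  Then "every ghost has
`λ(1) = 0`" iff "every `(S,T)`-EQUIVARIANT ghost has `λ(1) = 0`" for all types `S, T ∈ M_m(𝔽_p)`.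

* `nil_mul_nil`: the nilpotent parts `N(u) = u - 1` of a block radical (`u - 1` supported in
  `P × Q`, `P` and `Q` disjoint) multiply to zero, so `(u u') - 1 = N(u) + N(u')` and
  `u⁻¹ - 1 = -N(u)`: the block radical is a subgroup (`exists_blockRad`) on which
  `u ↦ ψ(tr(S N(u)))` is a character (`one_sub_coe_mul_inv`, `one_sub_coe_inv_mul`).
* the projection `λ_{S,T}(g) = Σ_{(u,v) ∈ U⁻ × U⁺} ψ(tr(S(1-u))) ψ(tr(T(1-v))) λ(u g v)` (written
  out as a sum over `L × R` for subgroups `L = U⁻`, `R = U⁺`) is supported on `H₁H₂H₃`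
  (`proj_support`, the sandwich), `(S,T)`-equivariant (`proj_mul_left`, `proj_mul_right`,
  reindexing over the radicals) and again a ghost (`proj_ghost`: `F_k` is bi-invariant,
  `rk(v⁻¹ M u⁻¹) ≤ rk M`).
* `sum_sum_proj_one`: `Σ_{S,T} λ_{S,T}(1) = p^{m²} p^{m²} λ(1)` by `ψ`-orthogonality over
  `M_m(𝔽_p)` (tree: `SubgroupIdentityDesigns.Negative.sum_psi_trace_mul`).
-/

set_option linter.dupNamespace false

noncomputable section

open scoped BigOperators Classical

namespace Summit.MatrixMultiplication.MatrixMultiplication.Theorems.GhostCalculusChebotarev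

open Summit.MatrixMultiplication.MatrixMultiplication.Theorems.SubgroupIdentityDesigns.Negative
  (CMat sum_psi_trace_mul)

namespace IsotypicSplitting

/-! ## Block radicals of `GL_m(𝔽_p)` -/

section Radicals

variable {p m : ℕ}

/-- For disjoint `P`, `Q` two nilpotent parts supported in the block `P × Q` multiply to zero:
`(u - 1)(u' - 1) = 0`. -/
theorem nil_mul_nil {P Q : Fin m → Prop} (hPQ : ∀ l, Q l → ¬ P l) {u u' : GL (Fin m) (ZMod p)}
    (hu : ∀ i j : Fin m, ((u : CMat p m) - 1) i j ≠ 0 → P i ∧ Q j)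
    (hu' : ∀ i j : Fin m, ((u' : CMat p m) - 1) i j ≠ 0 → P i ∧ Q j) :
    ((u : CMat p m) - 1) * ((u' : CMat p m) - 1) = 0 := by
  ext i j
  rw [Matrix.mul_apply, Matrix.zero_apply]
  refine Finset.sum_eq_zero fun l _ => ?_
  by_cases h1 : ((u : CMat p m) - 1) i l = 0
  · rw [h1, zero_mul]
  by_cases h2 : ((u' : CMat p m) - 1) l j = 0
  · rw [h2, mul_zero]
  exact absurd (hu' l j h2).1 (hPQ l (hu i l h1).2)

/-- `(u u') - 1 = (u - 1) + (u' - 1)` on a block radical. -/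
theorem coe_mul_sub_one {P Q : Fin m → Prop} (hPQ : ∀ l, Q l → ¬ P l) {u u' : GL (Fin m) (ZMod p)}
    (hu : ∀ i j : Fin m, ((u : CMat p m) - 1) i j ≠ 0 → P i ∧ Q j)
    (hu' : ∀ i j : Fin m, ((u' : CMat p m) - 1) i j ≠ 0 → P i ∧ Q j) :
    ((u * u' : GL (Fin m) (ZMod p)) : CMat p m) - 1 = ((u : CMat p m) - 1) + ((u' : CMat p m) - 1) := by
  have h := nil_mul_nil hPQ hu hu'
  rw [Units.val_mul]
  calc (u : CMat p m) * (u' : CMat p m) - 1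
      = ((u : CMat p m) - 1) * ((u' : CMat p m) - 1) +
          (((u : CMat p m) - 1) + ((u' : CMat p m) - 1)) := by noncomm_ring
    _ = ((u : CMat p m) - 1) + ((u' : CMat p m) - 1) := by rw [h, zero_add]

/-- `u⁻¹ - 1 = -(u - 1)` on a block radical (`(1 + N)(1 - N) = 1`). -/
theorem coe_inv_sub_one {P Q : Fin m → Prop} (hPQ : ∀ l, Q l → ¬ P l) {u : GL (Fin m) (ZMod p)}
    (hu : ∀ i j : Fin m, ((u : CMat p m) - 1) i j ≠ 0 → P i ∧ Q j) :
    ((u⁻¹ : GL (Fin m) (ZMod p)) : CMat p m) - 1 = -((u : CMat p m) - 1) := by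
  have h := nil_mul_nil hPQ hu hu
  have hinv : ((u⁻¹ : GL (Fin m) (ZMod p)) : CMat p m) = 1 - ((u : CMat p m) - 1) := by
    refine Units.inv_eq_of_mul_eq_one_right ?_
    calc (u : CMat p m) * (1 - ((u : CMat p m) - 1))
        = -(((u : CMat p m) - 1) * ((u : CMat p m) - 1)) + 1 := by noncomm_ring
      _ = 1 := by rw [h, neg_zero, zero_add]
  rw [hinv]
  abel

/-- The block radical `{u : u - 1 supported in P × Q}` (`P`, `Q` disjoint) is a subgroup of
`GL_m(𝔽_p)`. -/
theorem exists_blockRad (P Q : Fin m → Prop) (hPQ : ∀ l, Q l → ¬ P l) :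
    ∃ L : Subgroup (GL (Fin m) (ZMod p)),
      ∀ u, u ∈ L ↔ ∀ i j : Fin m, ((u : CMat p m) - 1) i j ≠ 0 → P i ∧ Q j := by
  exact ⟨{ carrier := {u | ∀ i j : Fin m, ((u : CMat p m) - 1) i j ≠ 0 → P i ∧ Q j}
           one_mem' := by
             intro i j hij
             rw [Units.val_one, sub_self, Matrix.zero_apply] at hij
             exact absurd rfl hij
           mul_mem' := by
             intro u u' hu hu' i j hij
             rw [coe_mul_sub_one hPQ hu hu', Matrix.add_apply] at hij
             by_cases h1 : ((u : CMat p m) - 1) i j = 0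
             · rw [h1, zero_add] at hij
               exact hu' i j hij
             · exact hu i j h1
           inv_mem' := by
             intro u hu i j hij
             rw [coe_inv_sub_one hPQ hu, Matrix.neg_apply, neg_ne_zero] at hij
             exact hu i j hij }, fun _ => Iff.rfl⟩

/-- `1 - u u₀⁻¹ = (1 - u) + (u₀ - 1)` on a block radical (left reindexing). -/
theorem one_sub_coe_mul_inv {P Q : Fin m → Prop} (hPQ : ∀ l, Q l → ¬ P l)
    {u u₀ : GL (Fin m) (ZMod p)} (hu : ∀ i j : Fin m, ((u : CMat p m) - 1) i j ≠ 0 → P i ∧ Q j)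
    (hu₀ : ∀ i j : Fin m, ((u₀ : CMat p m) - 1) i j ≠ 0 → P i ∧ Q j) :
    (1 : CMat p m) - ((u * u₀⁻¹ : GL (Fin m) (ZMod p)) : CMat p m) =
      (1 - (u : CMat p m)) + ((u₀ : CMat p m) - 1) := by
  have hu₀' : ∀ i j : Fin m, (((u₀⁻¹ : GL (Fin m) (ZMod p)) : CMat p m) - 1) i j ≠ 0 → P i ∧ Q j := by
    intro i j hij
    rw [coe_inv_sub_one hPQ hu₀, Matrix.neg_apply, neg_ne_zero] at hij
    exact hu₀ i j hij
  have h := coe_mul_sub_one hPQ hu hu₀'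
  rw [coe_inv_sub_one hPQ hu₀] at h
  calc (1 : CMat p m) - ((u * u₀⁻¹ : GL (Fin m) (ZMod p)) : CMat p m)
      = -(((u * u₀⁻¹ : GL (Fin m) (ZMod p)) : CMat p m) - 1) := (neg_sub _ _).symm
    _ = -(((u : CMat p m) - 1) + -((u₀ : CMat p m) - 1)) := by rw [h]
    _ = (1 - (u : CMat p m)) + ((u₀ : CMat p m) - 1) := by abel

/-- `1 - v₀⁻¹ v = (v₀ - 1) + (1 - v)` on a block radical (right reindexing). -/
theorem one_sub_coe_inv_mul {P Q : Fin m → Prop} (hPQ : ∀ l, Q l → ¬ P l)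
    {v₀ v : GL (Fin m) (ZMod p)} (hv₀ : ∀ i j : Fin m, ((v₀ : CMat p m) - 1) i j ≠ 0 → P i ∧ Q j)
    (hv : ∀ i j : Fin m, ((v : CMat p m) - 1) i j ≠ 0 → P i ∧ Q j) :
    (1 : CMat p m) - ((v₀⁻¹ * v : GL (Fin m) (ZMod p)) : CMat p m) =
      ((v₀ : CMat p m) - 1) + (1 - (v : CMat p m)) := by
  have hv₀' : ∀ i j : Fin m, (((v₀⁻¹ : GL (Fin m) (ZMod p)) : CMat p m) - 1) i j ≠ 0 → P i ∧ Q j := by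
    intro i j hij
    rw [coe_inv_sub_one hPQ hv₀, Matrix.neg_apply, neg_ne_zero] at hij
    exact hv₀ i j hij
  have h := coe_mul_sub_one hPQ hv₀' hv
  rw [coe_inv_sub_one hPQ hv₀] at h
  calc (1 : CMat p m) - ((v₀⁻¹ * v : GL (Fin m) (ZMod p)) : CMat p m)
      = -(((v₀⁻¹ * v : GL (Fin m) (ZMod p)) : CMat p m) - 1) := (neg_sub _ _).symm
    _ = -(-((v₀ : CMat p m) - 1) + ((v : CMat p m) - 1)) := by rw [h]
    _ = ((v₀ : CMat p m) - 1) + (1 - (v : CMat p m)) := by abel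

end Radicals

/-! ## The `(S,T)`-isotypic projection of a ghost

For subgroups `L, R ≤ GL_m(𝔽_p)` the projection of `λ` is written out as
`g ↦ Σ_{w ∈ L × R} ψ(tr(S(1 - w.1))) ψ(tr(T(1 - w.2))) λ(w.1 g w.2)`. -/

section Projection

variable {p m : ℕ} [Fact p.Prime]

/-- Two-sided translation of a level-`k` Fourier sum: `Σ_g λ(u g v) ψ(tr(M g)) =
Σ_g λ(g) ψ(tr((v⁻¹ M u⁻¹) g))`, which vanishes for a level-`k`-orthogonal `λ`
(`rk(v⁻¹ M u⁻¹) ≤ rk M ≤ k`: `F_k` is bi-invariant). -/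
theorem sum_translate_eq_zero {k : ℕ} {lam : GL (Fin m) (ZMod p) → ℂ}
    (hg : ∀ M : CMat p m, M.rank ≤ k →
      ∑ g : GL (Fin m) (ZMod p), lam g * ZMod.stdAddChar (Matrix.trace (M * (g : CMat p m))) = 0)
    (M : CMat p m) (hM : M.rank ≤ k) (u v : GL (Fin m) (ZMod p)) :
    ∑ g : GL (Fin m) (ZMod p),
      lam (u * g * v) * ZMod.stdAddChar (Matrix.trace (M * (g : CMat p m))) = 0 := by
  set M' : CMat p m := ((v⁻¹ : GL (Fin m) (ZMod p)) : CMat p m) * M *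
    ((u⁻¹ : GL (Fin m) (ZMod p)) : CMat p m) with hM'
  have htr : ∀ g : GL (Fin m) (ZMod p),
      Matrix.trace (M' * ((u * g * v : GL (Fin m) (ZMod p)) : CMat p m)) =
        Matrix.trace (M * (g : CMat p m)) := by
    intro g
    rw [hM', Units.val_mul, Units.val_mul]
    simp only [Matrix.mul_assoc, Units.inv_mul_cancel_left]
    rw [Matrix.trace_mul_comm]
    simp only [Matrix.mul_assoc, Units.mul_inv, Matrix.mul_one]
  have key : ∑ g : GL (Fin m) (ZMod p),
      lam (u * g * v) * ZMod.stdAddChar (Matrix.trace (M * (g : CMat p m))) =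
        ∑ g : GL (Fin m) (ZMod p), lam g * ZMod.stdAddChar (Matrix.trace (M' * (g : CMat p m))) := by
    conv_rhs => rw [← ((Equiv.mulLeft u).trans (Equiv.mulRight v)).sum_comp]
    refine Finset.sum_congr rfl fun g _ => ?_
    simp only [Equiv.trans_apply, Equiv.coe_mulLeft, Equiv.coe_mulRight]
    rw [htr]
  rw [key]
  exact hg _ ((Matrix.rank_mul_le_left _ _).trans ((Matrix.rank_mul_le_right _ _).trans hM))

/-- (a) Support: if `L ≤ H₁`, `R ≤ H₃` (the sandwich) and `λ` is supported on `H₁H₂H₃`, so is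
its projection. -/
theorem proj_support {L R H₁ H₂ H₃ : Subgroup (GL (Fin m) (ZMod p))} (hL : ∀ u ∈ L, u ∈ H₁)
    (hR : ∀ v ∈ R, v ∈ H₃) {S T : CMat p m} {lam : GL (Fin m) (ZMod p) → ℂ}
    (hs : ∀ g, lam g ≠ 0 → ∃ a ∈ H₁, ∃ b ∈ H₂, ∃ c ∈ H₃, g = a * b * c) :
    ∀ g, (∑ w : L × R, ZMod.stdAddChar (Matrix.trace (S * (1 - (w.1.1 : CMat p m)))) *
        ZMod.stdAddChar (Matrix.trace (T * (1 - (w.2.1 : CMat p m)))) * lam (w.1.1 * g * w.2.1)) ≠ 0 →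
      ∃ a ∈ H₁, ∃ b ∈ H₂, ∃ c ∈ H₃, g = a * b * c := by
  intro g hg
  obtain ⟨w, -, hw⟩ := Finset.exists_ne_zero_of_sum_ne_zero hg
  have hl : lam (w.1.1 * g * w.2.1) ≠ 0 := fun h => hw (by rw [h, mul_zero])
  obtain ⟨a, ha, b, hb, c, hc, habc⟩ := hs _ hl
  refine ⟨w.1.1⁻¹ * a, H₁.mul_mem (H₁.inv_mem (hL _ w.1.2)) ha, b, hb,
    c * w.2.1⁻¹, H₃.mul_mem hc (H₃.inv_mem (hR _ w.2.2)), ?_⟩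
  calc g = w.1.1⁻¹ * (w.1.1 * g * w.2.1) * w.2.1⁻¹ := by group
    _ = w.1.1⁻¹ * a * b * (c * w.2.1⁻¹) := by rw [habc]; group

/-- (b) Left `S`-equivariance for `L = U⁻` (the block radical of `P × Q`):
`λ_{S,T}(u₀ g) = ψ(tr(S(u₀ - 1))) λ_{S,T}(g)` for `u₀ ∈ U⁻` (reindex `u ↦ u u₀⁻¹`). -/
theorem proj_mul_left {P Q : Fin m → Prop} (hPQ : ∀ l, Q l → ¬ P l)
    {L : Subgroup (GL (Fin m) (ZMod p))}
    (hLmem : ∀ u, u ∈ L ↔ ∀ i j : Fin m, ((u : CMat p m) - 1) i j ≠ 0 → P i ∧ Q j)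
    (R : Subgroup (GL (Fin m) (ZMod p))) (S T : CMat p m) (lam : GL (Fin m) (ZMod p) → ℂ)
    {u₀ : GL (Fin m) (ZMod p)} (hu₀ : ∀ i j : Fin m, ((u₀ : CMat p m) - 1) i j ≠ 0 → P i ∧ Q j)
    (g : GL (Fin m) (ZMod p)) :
    (∑ w : L × R, ZMod.stdAddChar (Matrix.trace (S * (1 - (w.1.1 : CMat p m)))) *
        ZMod.stdAddChar (Matrix.trace (T * (1 - (w.2.1 : CMat p m)))) *
          lam (w.1.1 * (u₀ * g) * w.2.1)) =
      ZMod.stdAddChar (Matrix.trace (S * ((u₀ : CMat p m) - 1))) *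
        ∑ w : L × R, ZMod.stdAddChar (Matrix.trace (S * (1 - (w.1.1 : CMat p m)))) *
          ZMod.stdAddChar (Matrix.trace (T * (1 - (w.2.1 : CMat p m)))) * lam (w.1.1 * g * w.2.1) := by
  rw [Finset.mul_sum]
  conv_lhs => rw [← ((Equiv.mulRight (⟨u₀, (hLmem u₀).mpr hu₀⟩⁻¹ : L)).prodCongr
    (Equiv.refl R)).sum_comp]
  refine Finset.sum_congr rfl fun w _ => ?_
  simp only [Equiv.prodCongr_apply, Prod.map_fst, Prod.map_snd, Equiv.coe_mulRight,
    Equiv.coe_refl, id_eq, Subgroup.coe_mul, Subgroup.coe_inv]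
  rw [show (w.1 : GL (Fin m) (ZMod p)) * u₀⁻¹ * (u₀ * g) = (w.1 : GL (Fin m) (ZMod p)) * g by group,
    one_sub_coe_mul_inv hPQ ((hLmem _).mp w.1.2) hu₀, Matrix.mul_add, Matrix.trace_add,
    AddChar.map_add_eq_mul]
  ring

/-- (c) Right `T`-equivariance for `R = U⁺` (the block radical of `P × Q`):
`λ_{S,T}(g v₀) = ψ(tr(T(v₀ - 1))) λ_{S,T}(g)` for `v₀ ∈ U⁺` (reindex `v ↦ v₀⁻¹ v`). -/
theorem proj_mul_right {P Q : Fin m → Prop} (hPQ : ∀ l, Q l → ¬ P l)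
    (L : Subgroup (GL (Fin m) (ZMod p))) {R : Subgroup (GL (Fin m) (ZMod p))}
    (hRmem : ∀ v, v ∈ R ↔ ∀ i j : Fin m, ((v : CMat p m) - 1) i j ≠ 0 → P i ∧ Q j)
    (S T : CMat p m) (lam : GL (Fin m) (ZMod p) → ℂ)
    {v₀ : GL (Fin m) (ZMod p)} (hv₀ : ∀ i j : Fin m, ((v₀ : CMat p m) - 1) i j ≠ 0 → P i ∧ Q j)
    (g : GL (Fin m) (ZMod p)) :
    (∑ w : L × R, ZMod.stdAddChar (Matrix.trace (S * (1 - (w.1.1 : CMat p m)))) *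
        ZMod.stdAddChar (Matrix.trace (T * (1 - (w.2.1 : CMat p m)))) *
          lam (w.1.1 * (g * v₀) * w.2.1)) =
      ZMod.stdAddChar (Matrix.trace (T * ((v₀ : CMat p m) - 1))) *
        ∑ w : L × R, ZMod.stdAddChar (Matrix.trace (S * (1 - (w.1.1 : CMat p m)))) *
          ZMod.stdAddChar (Matrix.trace (T * (1 - (w.2.1 : CMat p m)))) * lam (w.1.1 * g * w.2.1) := by
  rw [Finset.mul_sum]
  conv_lhs => rw [← ((Equiv.refl L).prodCongr
    (Equiv.mulLeft (⟨v₀, (hRmem v₀).mpr hv₀⟩⁻¹ : R))).sum_comp]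
  refine Finset.sum_congr rfl fun w _ => ?_
  simp only [Equiv.prodCongr_apply, Prod.map_fst, Prod.map_snd, Equiv.coe_mulLeft,
    Equiv.coe_refl, id_eq, Subgroup.coe_mul, Subgroup.coe_inv]
  rw [show (w.1 : GL (Fin m) (ZMod p)) * (g * v₀) * (v₀⁻¹ * (w.2 : GL (Fin m) (ZMod p))) =
      (w.1 : GL (Fin m) (ZMod p)) * g * (w.2 : GL (Fin m) (ZMod p)) by group,
    one_sub_coe_inv_mul hPQ hv₀ ((hRmem _).mp w.2.2), Matrix.mul_add, Matrix.trace_add,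
    AddChar.map_add_eq_mul]
  ring

/-- (d) The projection of a level-`k`-orthogonal `λ` is level-`k`-orthogonal. -/
theorem proj_ghost {k : ℕ} (L R : Subgroup (GL (Fin m) (ZMod p))) (S T : CMat p m)
    {lam : GL (Fin m) (ZMod p) → ℂ}
    (hg : ∀ M : CMat p m, M.rank ≤ k →
      ∑ g : GL (Fin m) (ZMod p), lam g * ZMod.stdAddChar (Matrix.trace (M * (g : CMat p m))) = 0) :
    ∀ M : CMat p m, M.rank ≤ k →
      ∑ g : GL (Fin m) (ZMod p),
        (∑ w : L × R, ZMod.stdAddChar (Matrix.trace (S * (1 - (w.1.1 : CMat p m)))) *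
          ZMod.stdAddChar (Matrix.trace (T * (1 - (w.2.1 : CMat p m)))) * lam (w.1.1 * g * w.2.1)) *
          ZMod.stdAddChar (Matrix.trace (M * (g : CMat p m))) = 0 := by
  intro M hM
  simp_rw [Finset.sum_mul]
  rw [Finset.sum_comm]
  refine Finset.sum_eq_zero fun w _ => ?_
  have h := sum_translate_eq_zero hg M hM w.1.1 w.2.1
  simp_rw [mul_assoc, ← Finset.mul_sum]
  simp only [mul_assoc] at h
  rw [h, mul_zero, mul_zero]

/-- `ψ`-orthogonality over `M_m(𝔽_p)` read on `G`: `Σ_S ψ(tr(S(1 - w))) = p^{m²} [w = 1]`. -/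
theorem sum_psi_one_sub (w : GL (Fin m) (ZMod p)) :
    ∑ S : CMat p m, ZMod.stdAddChar (Matrix.trace (S * (1 - (w : CMat p m)))) =
      if w = 1 then ((p : ℂ) ^ (m * m)) else 0 := by
  rw [sum_psi_trace_mul]
  exact if_congr ⟨fun h => Units.val_eq_one.mp (sub_eq_zero.mp h).symm,
    fun h => by rw [h, Units.val_one, sub_self]⟩ rfl rfl

/-- Summing the projections over all types: `Σ_{S,T} λ_{S,T}(1) = p^{m²} p^{m²} λ(1)`. -/
theorem sum_sum_proj_one (L R : Subgroup (GL (Fin m) (ZMod p))) (lam : GL (Fin m) (ZMod p) → ℂ) :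
    ∑ S : CMat p m, ∑ T : CMat p m, ∑ w : L × R,
        ZMod.stdAddChar (Matrix.trace (S * (1 - (w.1.1 : CMat p m)))) *
          ZMod.stdAddChar (Matrix.trace (T * (1 - (w.2.1 : CMat p m)))) * lam (w.1.1 * 1 * w.2.1) =
      (p : ℂ) ^ (m * m) * (p : ℂ) ^ (m * m) * lam 1 := by
  calc ∑ S : CMat p m, ∑ T : CMat p m, ∑ w : L × R,
        ZMod.stdAddChar (Matrix.trace (S * (1 - (w.1.1 : CMat p m)))) *
          ZMod.stdAddChar (Matrix.trace (T * (1 - (w.2.1 : CMat p m)))) * lam (w.1.1 * 1 * w.2.1)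
      = ∑ w : L × R, (∑ S : CMat p m, ZMod.stdAddChar (Matrix.trace (S * (1 - (w.1.1 : CMat p m))))) *
          (∑ T : CMat p m, ZMod.stdAddChar (Matrix.trace (T * (1 - (w.2.1 : CMat p m))))) *
            lam (w.1.1 * 1 * w.2.1) := by
        simp_rw [Finset.sum_mul_sum, Finset.sum_mul]
        symm
        rw [Finset.sum_comm]
        exact Finset.sum_congr rfl fun S _ => Finset.sum_comm
    _ = ∑ w : L × R, ((if (w.1 : GL (Fin m) (ZMod p)) = 1 then ((p : ℂ) ^ (m * m)) else 0) *
          (if (w.2 : GL (Fin m) (ZMod p)) = 1 then ((p : ℂ) ^ (m * m)) else 0) *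
            lam (w.1.1 * 1 * w.2.1)) := by
        simp_rw [sum_psi_one_sub]
    _ = (p : ℂ) ^ (m * m) * (p : ℂ) ^ (m * m) * lam 1 := by
        rw [Finset.sum_eq_single (1 : L × R)]
        · simp
        · intro w _ hw
          by_cases h1 : (w.1 : GL (Fin m) (ZMod p)) = 1
          · have h2 : (w.2 : GL (Fin m) (ZMod p)) ≠ 1 := fun h2 =>
              hw (Prod.ext (OneMemClass.coe_eq_one.mp h1) (OneMemClass.coe_eq_one.mp h2))
            rw [if_neg h2, mul_zero, zero_mul]
          · rw [if_neg h1, zero_mul, zero_mul]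
        · exact fun h => absurd (Finset.mem_univ _) h

end Projection

end IsotypicSplitting

/-! ## The registered stub -/

variable {p m : ℕ} [Fact p.Prime]

open IsotypicSplitting in
/-- **Isotypic splitting along the two abelian radicals** (stub `stub_isotypicSplitting` of the line
`ghost-calculus-chebotarev`).  SANDWICH hypothesis: `H₁` contains every unipotent `u` with `u - 1`
supported in the block `{(i,j) : k ≤ i, j < k}` (the opposite radical `U_P⁻ = {[[1,0],[X,1]]}` of
the maximal parabolic `P = P_{k,m-k}`), and `H₃` contains every `v` with `v - 1` supported in
`{(i,j) : i < k, k ≤ j}` (the radical `U_P = {[[1,Z],[0,1]]}`).  Then "every ghost (supported on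
`H₁H₂H₃`, all level-`k` Fourier sums zero) has `λ(1) = 0`" IFF the same holds for the
`(S,T)`-EQUIVARIANT ghosts only, for every pair of types `S, T ∈ M_m(𝔽_p)`:
`λ(u g) = ψ(tr(S (u-1))) λ(g)` for `u ∈ U_P⁻` and `λ(g v) = ψ(tr(T (v-1))) λ(g)` for `v ∈ U_P`.
`→` is a special case; `←` projects a ghost `λ` to the equivariant ghosts `λ_{S,T}`, each
vanishing at `1`, and sums over all types: `Σ_{S,T} λ_{S,T}(1) = p^{2m²} λ(1)` by
`ψ`-orthogonality over `M_m(𝔽_p)`. -/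
theorem stub_isotypicSplitting (k : ℕ)
    (H₁ H₂ H₃ : Subgroup (Matrix.GeneralLinearGroup (Fin m) (ZMod p)))
    (hL : ∀ u : Matrix.GeneralLinearGroup (Fin m) (ZMod p),
      (∀ i j : Fin m, ((u : Matrix (Fin m) (Fin m) (ZMod p)) - 1) i j ≠ 0 → k ≤ i.val ∧ j.val < k) →
        u ∈ H₁)
    (hR : ∀ v : Matrix.GeneralLinearGroup (Fin m) (ZMod p),
      (∀ i j : Fin m, ((v : Matrix (Fin m) (Fin m) (ZMod p)) - 1) i j ≠ 0 → i.val < k ∧ k ≤ j.val) →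
        v ∈ H₃) :
    (∀ lam : Matrix.GeneralLinearGroup (Fin m) (ZMod p) → ℂ,
        (∀ g, lam g ≠ 0 → ∃ a ∈ H₁, ∃ b ∈ H₂, ∃ c ∈ H₃, g = a * b * c) →
        (∀ M : Matrix (Fin m) (Fin m) (ZMod p), M.rank ≤ k →
          ∑ g : Matrix.GeneralLinearGroup (Fin m) (ZMod p),
            lam g * ZMod.stdAddChar (Matrix.trace (M * (g : Matrix (Fin m) (Fin m) (ZMod p)))) = 0) →
        lam 1 = 0) ↔
      ∀ (S T : Matrix (Fin m) (Fin m) (ZMod p))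
        (lam : Matrix.GeneralLinearGroup (Fin m) (ZMod p) → ℂ),
        (∀ g, lam g ≠ 0 → ∃ a ∈ H₁, ∃ b ∈ H₂, ∃ c ∈ H₃, g = a * b * c) →
        (∀ u : Matrix.GeneralLinearGroup (Fin m) (ZMod p),
          (∀ i j : Fin m, ((u : Matrix (Fin m) (Fin m) (ZMod p)) - 1) i j ≠ 0 → k ≤ i.val ∧ j.val < k) →
            ∀ g, lam (u * g) =
              ZMod.stdAddChar (Matrix.trace (S * ((u : Matrix (Fin m) (Fin m) (ZMod p)) - 1))) * lam g) →
        (∀ v : Matrix.GeneralLinearGroup (Fin m) (ZMod p),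
          (∀ i j : Fin m, ((v : Matrix (Fin m) (Fin m) (ZMod p)) - 1) i j ≠ 0 → i.val < k ∧ k ≤ j.val) →
            ∀ g, lam (g * v) =
              ZMod.stdAddChar (Matrix.trace (T * ((v : Matrix (Fin m) (Fin m) (ZMod p)) - 1))) * lam g) →
        (∀ M : Matrix (Fin m) (Fin m) (ZMod p), M.rank ≤ k →
          ∑ g : Matrix.GeneralLinearGroup (Fin m) (ZMod p),
            lam g * ZMod.stdAddChar (Matrix.trace (M * (g : Matrix (Fin m) (Fin m) (ZMod p)))) = 0) →
        lam 1 = 0 := by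
  refine ⟨fun h S T lam hs _ _ hg => h lam hs hg, fun h lam hs hg => ?_⟩
  -- the two radicals `L = U⁻`, `R = U⁺` as subgroups
  have hPQ : ∀ l : Fin m, l.val < k → ¬ k ≤ l.val := fun _ h1 h2 => (not_lt.mpr h2) h1
  have hQP : ∀ l : Fin m, k ≤ l.val → ¬ l.val < k := fun _ h1 => not_lt.mpr h1
  obtain ⟨L, hLmem⟩ := exists_blockRad (p := p) (fun i : Fin m => k ≤ i.val) (fun j => j.val < k) hPQ
  obtain ⟨R, hRmem⟩ := exists_blockRad (p := p) (fun i : Fin m => i.val < k) (fun j => k ≤ j.val) hQP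
  -- every projection `λ_{S,T}` is an `(S,T)`-equivariant ghost, hence vanishes at `1`
  have h0 : ∀ S T : CMat p m, (∑ w : L × R,
      ZMod.stdAddChar (Matrix.trace (S * (1 - (w.1.1 : CMat p m)))) *
        ZMod.stdAddChar (Matrix.trace (T * (1 - (w.2.1 : CMat p m)))) * lam (w.1.1 * 1 * w.2.1)) = 0 :=
    fun S T => h S T (fun g => ∑ w : L × R,
        ZMod.stdAddChar (Matrix.trace (S * (1 - (w.1.1 : CMat p m)))) *
          ZMod.stdAddChar (Matrix.trace (T * (1 - (w.2.1 : CMat p m)))) * lam (w.1.1 * g * w.2.1))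
      (proj_support (fun u hu => hL u ((hLmem u).mp hu)) (fun v hv => hR v ((hRmem v).mp hv)) hs)
      (fun u hu g => proj_mul_left hPQ hLmem R S T lam hu g)
      (fun v hv g => proj_mul_right hQP L hRmem S T lam hv g)
      (proj_ghost L R S T hg)
  -- sum over all types
  have hsum := Finset.sum_eq_zero fun S (_ : S ∈ (Finset.univ : Finset (CMat p m))) =>
    Finset.sum_eq_zero fun T (_ : T ∈ (Finset.univ : Finset (CMat p m))) => h0 S T
  rw [sum_sum_proj_one L R lam] at hsum
  have hP : ((p : ℂ) ^ (m * m)) ≠ 0 :=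
    pow_ne_zero _ (Nat.cast_ne_zero.mpr (Fact.out : p.Prime).ne_zero)
  exact (mul_eq_zero.mp hsum).resolve_left (mul_ne_zero hP hP)

end Summit.MatrixMultiplication.MatrixMultiplication.Theorems.GhostCalculusChebotarev

end
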